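import Literature.MathematicalPhysics.QuantumFieldTheory.Balaban1983to89.T4CubeChartExp
import Literature.MathematicalPhysics.QuantumFieldTheory.Balaban1983to89.UnitaryModel

/-!
# TN-GR ORGAN TELESCOPE: `HClauseSq` (the O1ᵘ-H scaled pair clause on the window) ⇒ first differences along window paths

`CURRENCY-MEMO-g26.md` §10.3∕§10.5∕§10.9; critic #570 (A), #573 (i)(ii), #576 (v).  Instantiates the abstract windowed telescope (`Tele.firstDiff_telescope_on`,
= `GRTelescope.lean` v1.1 restated by text) with `act U b v := update U b (U b * expPt v)` (RIGHT exponential moves, the `HClauseSq` convention incl. the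
same-bond order), `Good := PlaqSmall θ`, `sz v := ‖v‖ ∕ θ`, cap `r`.
* the clause `HClauseSq θ r k R` of the HOME draft `O1uH_draft.lean` 479029739d3717fc is carried as an explicit hypothesis `h` (relational phrasing, verbatim).
* `clause_update_of_HClauseSq` — the relational clause specialised to `update` moves (the four corners `U`, `act U b v`, `act U b′ v′`, `act (act U b v) b′ v′`).
* ★★ `firstDiff_window_path` — for `HClauseSq θ r k R`, `0 < θ`, a path of window-size moves whose prefixes and their `b`-excitations stay `PlaqSmall θ`,
  and an anchor letter `G` at the start: `|R (update U_N b (U_N b * expPt v)) − R U_N| ≤ (G + Σ_{(bᵢ,vᵢ)∈path} k bᵢ b · ‖vᵢ‖∕θ) · ‖v‖∕θ`.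
  With the flat anchor `U₀ = 1` and `G = 0` (`GRFlatEven.flatGradient_zero` gives the DERIVATIVE; the finite-difference anchor letter needs the
  H-clause once more or a mean-value step — NOT done here: `G` stays a hypothesis), this is (GR-a)'s first-difference bound = (column mass) × (per-bond
  move count) × size.
HONEST: bookkeeping, kernel-checked; nothing about the runs; `HClauseSq` for the runs' R is O1ᵘ-H's OUTPUT, unproved; nothing of O1∕O1ᵘ-H∕S3∕20520∕`YM3TorusSU2`
proved; registry №36 intact; R3 = SU(2) YM₃ on T³ — NOT d = 4, NOT infinite volume, NOT a mass gap, NOT Clay.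
-/

namespace Summit.QuantumFields.YangMills.Cruxes.FluctuationComparisonRegPrIntL.GROrganTelescope.Tele

variable {X ι M : Type*}

/-- Apply the (bond, move) pairs of `path` successively, starting from `U`. -/
def applyPath (act : X → ι → M → X) (U : X) (path : List (ι × M)) : X :=
  path.foldl (fun V p => act V p.1 p.2) U

theorem applyPath_nil (act : X → ι → M → X) (U : X) : applyPath act U [] = U := rfl

theorem applyPath_cons (act : X → ι → M → X) (U : X) (p : ι × M) (ps : List (ι × M)) :
    applyPath act U (p :: ps) = applyPath act (act U p.1 p.2) ps := rfl

/-- ONE STEP: the scaled pair clause moves a first-difference bound across one move, at the cost of one column entry of `k`. -/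
theorem firstDiff_step (act : X → ι → M → X) (sz : M → ℝ) (f : X → ℝ) (k : ι → ι → ℝ)
    (hH : ∀ (U : X) (b b' : ι) (m m' : M),
      |f (act (act U b m) b' m') - f (act U b m) - f (act U b' m') + f U| ≤ k b b' * sz m * sz m')
    (U₀ : X) (G : ι → ℝ) (hG : ∀ b m, |f (act U₀ b m) - f U₀| ≤ G b * sz m) (p : ι × M) :
    ∀ b m, |f (act (act U₀ p.1 p.2) b m) - f (act U₀ p.1 p.2)| ≤ (G b + k p.1 b * sz p.2) * sz m := by
  intro b m
  have h1 := hH U₀ p.1 b p.2 m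
  have h2 := hG b m
  have hsplit : f (act (act U₀ p.1 p.2) b m) - f (act U₀ p.1 p.2)
      = (f (act U₀ b m) - f U₀) + (f (act (act U₀ p.1 p.2) b m) - f (act U₀ p.1 p.2) - f (act U₀ b m) + f U₀) := by ring
  rw [hsplit]
  calc |(f (act U₀ b m) - f U₀) + (f (act (act U₀ p.1 p.2) b m) - f (act U₀ p.1 p.2) - f (act U₀ b m) + f U₀)|
        ≤ |f (act U₀ b m) - f U₀| + |f (act (act U₀ p.1 p.2) b m) - f (act U₀ p.1 p.2) - f (act U₀ b m) + f U₀| := abs_add_le _ _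
    _ ≤ G b * sz m + k p.1 b * sz p.2 * sz m := add_le_add h2 h1
    _ = (G b + k p.1 b * sz p.2) * sz m := by ring

/-- ★ TELESCOPING ALONG A PATH: anchor letters `G` at the start, plus path length × column mass of `k`, bound the first differences at the end. -/
theorem firstDiff_telescope (act : X → ι → M → X) (sz : M → ℝ) (f : X → ℝ) (k : ι → ι → ℝ)
    (hH : ∀ (U : X) (b b' : ι) (m m' : M),
      |f (act (act U b m) b' m') - f (act U b m) - f (act U b' m') + f U| ≤ k b b' * sz m * sz m') :
    ∀ (path : List (ι × M)) (U₀ : X) (G : ι → ℝ),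
      (∀ b m, |f (act U₀ b m) - f U₀| ≤ G b * sz m) →
      ∀ b m, |f (act (applyPath act U₀ path) b m) - f (applyPath act U₀ path)|
        ≤ (G b + (path.map (fun p => k p.1 b * sz p.2)).sum) * sz m := by
  intro path
  induction path with
  | nil =>
    intro U₀ G hG b m
    simpa [applyPath] using hG b m
  | cons p ps ih =>
    intro U₀ G hG b m
    have hstart := firstDiff_step act sz f k hH U₀ G hG p
    have h := ih (act U₀ p.1 p.2) (fun b => G b + k p.1 b * sz p.2) hstart b m
    rw [applyPath_cons]
    simpa [List.map_cons, List.sum_cons, add_assoc] using h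

/-- The ANCHORED form of (GR-a): anchor at `U₀` with letters `g⁰`, any path; the end-point first differences are bounded by
`(g⁰ b + N · κ_b) · sz m` whenever every step's column entry is `≤ κ_b` (e.g. `κ_b = Σ_{b′} k b′ b` for `k ≥ 0`) and the path has length `N`. -/
theorem firstDiff_of_anchor_and_length (act : X → ι → M → X) (sz : M → ℝ) (f : X → ℝ) (k : ι → ι → ℝ)
    (hH : ∀ (U : X) (b b' : ι) (m m' : M),
      |f (act (act U b m) b' m') - f (act U b m) - f (act U b' m') + f U| ≤ k b b' * sz m * sz m')
    (U₀ : X) (g₀ : ι → ℝ) (hg : ∀ b m, |f (act U₀ b m) - f U₀| ≤ g₀ b * sz m)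
    (path : List (ι × M)) (b : ι) (κb : ℝ) (hκ : ∀ p ∈ path, k p.1 b * sz p.2 ≤ κb)
    (m : M) (hm : 0 ≤ sz m) :
    |f (act (applyPath act U₀ path) b m) - f (applyPath act U₀ path)| ≤ (g₀ b + path.length * κb) * sz m := by
  have h := firstDiff_telescope act sz f k hH path U₀ g₀ hg b m
  have hsum : (path.map (fun p => k p.1 b * sz p.2)).sum ≤ path.length * κb := by
    have := List.sum_le_card_nsmul (path.map (fun p => k p.1 b * sz p.2)) κb (by
      intro x hx
      obtain ⟨p, hp, rfl⟩ := List.mem_map.1 hx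
      exact hκ p hp)
    simpa [List.length_map, nsmul_eq_mul] using this
  calc |f (act (applyPath act U₀ path) b m) - f (applyPath act U₀ path)|
        ≤ (g₀ b + (path.map (fun p => k p.1 b * sz p.2)).sum) * sz m := h
    _ ≤ (g₀ b + path.length * κb) * sz m := by
        apply mul_le_mul_of_nonneg_right _ hm
        linarith

/-! ## Windowed form (the organ's clause holds only on the small-field window and for window-size moves)

`Good : X → Prop` is the window, `ρ` the move-size cap.  The clause is assumed only when all four corners of the square are `Good` and both moves
have size `≤ ρ`; the path hypotheses say every prefix configuration and its `b`-excitation stay `Good` and every move is window-size. -/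

/-- ONE WINDOWED STEP. -/
theorem firstDiff_step_on (Good : X → Prop) (ρ : ℝ) (act : X → ι → M → X) (sz : M → ℝ) (f : X → ℝ) (k : ι → ι → ℝ)
    (hH : ∀ (U : X) (b b' : ι) (m m' : M), Good U → Good (act U b m) → Good (act U b' m') → Good (act (act U b m) b' m') →
      sz m ≤ ρ → sz m' ≤ ρ → |f (act (act U b m) b' m') - f (act U b m) - f (act U b' m') + f U| ≤ k b b' * sz m * sz m')
    (U₀ : X) (p : ι × M) (b : ι) (m : M)
    (hU₀ : Good U₀) (hU₁ : Good (act U₀ p.1 p.2)) (hU₀b : Good (act U₀ b m)) (hU₁b : Good (act (act U₀ p.1 p.2) b m))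
    (hp : sz p.2 ≤ ρ) (hm : sz m ≤ ρ)
    (G : ℝ) (hG : |f (act U₀ b m) - f U₀| ≤ G * sz m) :
    |f (act (act U₀ p.1 p.2) b m) - f (act U₀ p.1 p.2)| ≤ (G + k p.1 b * sz p.2) * sz m := by
  have h1 := hH U₀ p.1 b p.2 m hU₀ hU₁ hU₀b hU₁b hp hm
  have hsplit : f (act (act U₀ p.1 p.2) b m) - f (act U₀ p.1 p.2)
      = (f (act U₀ b m) - f U₀) + (f (act (act U₀ p.1 p.2) b m) - f (act U₀ p.1 p.2) - f (act U₀ b m) + f U₀) := by ring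
  rw [hsplit]
  calc |(f (act U₀ b m) - f U₀) + (f (act (act U₀ p.1 p.2) b m) - f (act U₀ p.1 p.2) - f (act U₀ b m) + f U₀)|
        ≤ |f (act U₀ b m) - f U₀| + |f (act (act U₀ p.1 p.2) b m) - f (act U₀ p.1 p.2) - f (act U₀ b m) + f U₀| := abs_add_le _ _
    _ ≤ G * sz m + k p.1 b * sz p.2 * sz m := add_le_add hG h1
    _ = (G + k p.1 b * sz p.2) * sz m := by ring

/-- ★ WINDOWED TELESCOPING: for a fixed target bond `b` and move `m`, if every prefix of the path and its `b`-excitation are `Good` and all moves are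
window-size, the first difference at the end is bounded by `(G + Σ_{(bᵢ, mᵢ) ∈ path} k bᵢ b · sz mᵢ) · sz m`, `G` the anchor letter at `U₀`. -/
theorem firstDiff_telescope_on (Good : X → Prop) (ρ : ℝ) (act : X → ι → M → X) (sz : M → ℝ) (f : X → ℝ) (k : ι → ι → ℝ)
    (hH : ∀ (U : X) (b b' : ι) (m m' : M), Good U → Good (act U b m) → Good (act U b' m') → Good (act (act U b m) b' m') →
      sz m ≤ ρ → sz m' ≤ ρ → |f (act (act U b m) b' m') - f (act U b m) - f (act U b' m') + f U| ≤ k b b' * sz m * sz m')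
    (b : ι) (m : M) (hm : sz m ≤ ρ) :
    ∀ (path : List (ι × M)) (U₀ : X) (G : ℝ),
      (∀ p ∈ path, sz p.2 ≤ ρ) →
      (∀ n ≤ path.length, Good (applyPath act U₀ (path.take n)) ∧ Good (act (applyPath act U₀ (path.take n)) b m)) →
      |f (act U₀ b m) - f U₀| ≤ G * sz m →
      |f (act (applyPath act U₀ path) b m) - f (applyPath act U₀ path)|
        ≤ (G + (path.map (fun p => k p.1 b * sz p.2)).sum) * sz m := by
  intro path
  induction path with
  | nil =>
    intro U₀ G _ _ hG
    simpa [applyPath] using hG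
  | cons p ps ih =>
    intro U₀ G hsz hgood hG
    have h0 := hgood 0 (Nat.zero_le _)
    have h1 := hgood 1 (by simp)
    simp only [List.take_zero, applyPath_nil] at h0
    simp only [List.take_succ_cons, List.take_zero, applyPath_cons, applyPath_nil] at h1
    have hstart := firstDiff_step_on Good ρ act sz f k hH U₀ p b m h0.1 h1.1 h0.2 h1.2 (hsz p (by simp)) hm G hG
    have hsz' : ∀ q ∈ ps, sz q.2 ≤ ρ := fun q hq => hsz q (List.mem_cons_of_mem p hq)
    have hgood' : ∀ n ≤ ps.length, Good (applyPath act (act U₀ p.1 p.2) (ps.take n)) ∧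
        Good (act (applyPath act (act U₀ p.1 p.2) (ps.take n)) b m) := by
      intro n hn
      have := hgood (n + 1) (by simpa using hn)
      simpa [List.take_succ_cons, applyPath_cons] using this
    have h := ih (act U₀ p.1 p.2) (G + k p.1 b * sz p.2) hsz' hgood' hstart
    rw [applyPath_cons]
    simpa [List.map_cons, List.sum_cons, add_assoc] using h

end Summit.QuantumFields.YangMills.Cruxes.FluctuationComparisonRegPrIntL.GROrganTelescope.Tele

namespace Summit.QuantumFields.YangMills.Cruxes.FluctuationComparisonRegPrIntL.GROrganTelescope

open Literature.MathematicalPhysics.QuantumFieldTheory.Balaban1983to89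
open T4CubeChartExp (expPt)
open T4CubeChartGnomonic (SU2)
open Function (update)

variable {P : Params} {j : ℕ}

/-! `HClauseSq θ r k R` (HOME draft `O1uH_draft.lean`, the SCALED one-bond-pair clause of O1ᵘ-H) is carried below as the explicit hypothesis `h`
(relational phrasing, verbatim), so that this file declares no `Prop`-valued definition. -/

/-- The RIGHT exponential move at a bond. -/
noncomputable def move (U : GaugeField P j SU2) (b : PBond P j) (v : Fin 3 → ℝ) : GaugeField P j SU2 :=
  @update _ _ (Classical.decEq _) U b (U b * expPt v)

theorem move_apply_self (U : GaugeField P j SU2) (b : PBond P j) (v : Fin 3 → ℝ) : move U b v b = U b * expPt v := by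
  simp [move]

theorem move_apply_of_ne (U : GaugeField P j SU2) (b : PBond P j) (v : Fin 3 → ℝ) {e : PBond P j} (he : e ≠ b) : move U b v e = U e := by
  simp [move, he]

/-- The relational clause specialised to `update` moves. -/
theorem clause_update_of_HClauseSq {θ r : ℝ} (hθ : 0 < θ) {k : PBond P j → PBond P j → ℝ} {R : GaugeField P j SU2 → ℝ}
    (h : ∀ (b b' : PBond P j) (v v' : Fin 3 → ℝ) (U V W Z : GaugeField P j SU2),
      ‖v‖ ≤ r * θ → ‖v'‖ ≤ r * θ → PlaqSmall θ U → PlaqSmall θ V → PlaqSmall θ W → PlaqSmall θ Z →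
      (∀ e, e ≠ b → V e = U e) → V b = U b * expPt v → (∀ e, e ≠ b' → W e = U e) → W b' = U b' * expPt v' →
      (∀ e, e ≠ b' → Z e = V e) → Z b' = V b' * expPt v' →
      |R Z - R V - R W + R U| ≤ k b b' * (‖v‖ / θ) * (‖v'‖ / θ)) :
    ∀ (U : GaugeField P j SU2) (b b' : PBond P j) (v v' : Fin 3 → ℝ),
      PlaqSmall θ U → PlaqSmall θ (move U b v) → PlaqSmall θ (move U b' v') → PlaqSmall θ (move (move U b v) b' v') →
      ‖v‖ / θ ≤ r → ‖v'‖ / θ ≤ r →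
      |R (move (move U b v) b' v') - R (move U b v) - R (move U b' v') + R U| ≤ k b b' * (‖v‖ / θ) * (‖v'‖ / θ) := by
  intro U b b' v v' hU hV hW hZ hv hv'
  have hv1 : ‖v‖ ≤ r * θ := by rwa [div_le_iff₀ hθ] at hv
  have hv1' : ‖v'‖ ≤ r * θ := by rwa [div_le_iff₀ hθ] at hv'
  exact h b b' v v' U (move U b v) (move U b' v') (move (move U b v) b' v') hv1 hv1' hU hV hW hZ
    (fun e he => move_apply_of_ne U b v he) (move_apply_self U b v)
    (fun e he => move_apply_of_ne U b' v' he) (move_apply_self U b' v')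
    (fun e he => move_apply_of_ne _ b' v' he) (move_apply_self _ b' v')

/-- ★★ FIRST DIFFERENCES ALONG A WINDOW PATH from the scaled pair clause: anchor letter `G` + Σ over the path of column entries `k bᵢ b · ‖vᵢ‖∕θ`,
times the size `‖v‖∕θ` of the probing move. -/
theorem firstDiff_window_path {θ r : ℝ} (hθ : 0 < θ) {k : PBond P j → PBond P j → ℝ} {R : GaugeField P j SU2 → ℝ}
    (h : ∀ (b b' : PBond P j) (v v' : Fin 3 → ℝ) (U V W Z : GaugeField P j SU2),
      ‖v‖ ≤ r * θ → ‖v'‖ ≤ r * θ → PlaqSmall θ U → PlaqSmall θ V → PlaqSmall θ W → PlaqSmall θ Z →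
      (∀ e, e ≠ b → V e = U e) → V b = U b * expPt v → (∀ e, e ≠ b' → W e = U e) → W b' = U b' * expPt v' →
      (∀ e, e ≠ b' → Z e = V e) → Z b' = V b' * expPt v' →
      |R Z - R V - R W + R U| ≤ k b b' * (‖v‖ / θ) * (‖v'‖ / θ)) (b : PBond P j) (v : Fin 3 → ℝ) (hv : ‖v‖ / θ ≤ r)
    (path : List (PBond P j × (Fin 3 → ℝ))) (U₀ : GaugeField P j SU2) (G : ℝ)
    (hsz : ∀ p ∈ path, ‖p.2‖ / θ ≤ r)
    (hgood : ∀ n ≤ path.length, PlaqSmall θ (Tele.applyPath move U₀ (path.take n)) ∧ PlaqSmall θ (move (Tele.applyPath move U₀ (path.take n)) b v))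
    (hG : |R (move U₀ b v) - R U₀| ≤ G * (‖v‖ / θ)) :
    |R (move (Tele.applyPath move U₀ path) b v) - R (Tele.applyPath move U₀ path)|
      ≤ (G + (path.map (fun p => k p.1 b * (‖p.2‖ / θ))).sum) * (‖v‖ / θ) :=
  Tele.firstDiff_telescope_on (PlaqSmall θ) r move (fun w : Fin 3 → ℝ => ‖w‖ / θ) R k
    (clause_update_of_HClauseSq hθ h) b v hv path U₀ G hsz hgood hG

end Summit.QuantumFields.YangMills.Cruxes.FluctuationComparisonRegPrIntL.GROrganTelescope
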